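import Mathlib
import Summits.Ventures.PercRepro2.Defs
import Summits.Ventures.PercRepro2.Graph
import Summits.Ventures.PercRepro2.OneColourSwitch
import Summits.Ventures.PercRepro2.RegionHubSign
import Summits.Ventures.PercRepro2.SideSwitch
import Summits.Ventures.PercRepro2.SideSwitchFibre
import Summits.Ventures.PercRepro2.SideSwitchClosed
import Summits.Ventures.PercRepro2.SideSwitchComps
import Summits.Ventures.PercRepro2.M9NoPocketDefs
import Summits.Ventures.PercRepro2.M9NoPocketWorld
import Summits.Ventures.PercRepro2.M9NoPocketWorldD
import Summits.Ventures.PercRepro2.M9NoPocketFibre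
import Summits.Ventures.PercRepro2.M9GeneralDSplit
import Summits.Ventures.PercRepro2.M9GeneralDHD
import Summits.Ventures.PercRepro2.M9SubcubeHarris
import Summits.Ventures.PercRepro2.M9ClusterFibreHarris
import Summits.Ventures.PercRepro2.M9PocketUnitFibre
import Summits.Ventures.PercRepro2.M9PocketUnitFibreSum
import Summits.Ventures.PercRepro2.M9PocketUnitKonly
import Summits.Ventures.PercRepro2.M9PocketPsi2
import Summits.Ventures.PercRepro2.M9PocketPsi2Sign
import Summits.Ventures.PercRepro2.M9PocketProdPoint
import Summits.Ventures.PercRepro2.M9PocketProdWorlds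
import Summits.Ventures.PercRepro2.M9PocketProdMono
import Summits.Ventures.PercRepro2.M9PocketProdSkel
import Summits.Ventures.PercRepro2.M9PocketProdFam
import Summits.Ventures.PercRepro2.M9PocketProdPartition
import Summits.Ventures.PercRepro2.M9PocketProdWsideFam

/-!
# [`T`-edge chain] # The `W`-side of a `K`-only point is a union of switchable blocks of its skeleton
(blind cell PercRepro2, p3 g39 / g40, 2026-08-29; `proofs/P3-POCKETRK.md` §10 (d): the free-block
extension, part 10)

For a `K`-only legal point `ω` with skeleton `ρ` (`M9PocketProdPartition`): the sided sets of
`ρ` and `ω` agree, the `W`-side of `ω` carries no `d`-edge, and every `W`-side vertex lies in a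
component of the sided set of `ρ` which is free, not attached to the cluster of `d` and
contained in the `W`-side — i.e. in the family of switchable blocks of `ρ`
(`wside_block_mem_fam`).  This is the hypothesis `hfam` of `prod_index_eq` for the family
`𝔉 = fam ρ`.  T-VARIANT (p3 g39, `proofs/P3-POCKETRK.md` §10‴): the hypothesis «no `d r`, `d s` edge» is
replaced by `hM : d ∉ M₂(ρ)` (every `T`-edge is `Y` at a `K`-only point); the lemmas carry the
suffix `_T`, the `hT`-free lemmas are those of the original file.  Own work; std axioms.
-/

namespace Summit.Ventures.PercRepro2

namespace NoPocket

open Finset Classical OneColourSwitch SideSwitch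

variable {V : Type*} {E : Type*} {ends : E → Sym2 V} {p q r s d : V} {ω : Config E}

section WsideFam

variable [Fintype V] [DecidableEq V]
  (hdr : d ≠ r) (hds : d ≠ s) (hrs : within ends ({r, s} : Set V) = ∅)
  (hsep : sep2 ends p q r s ω) (hD : DOne ends r s d ω) (hK : d ∈ K2 ends r s ω)
  (hM : d ∉ M2 ends r s ω)
  {ρ : Config E}
  (hρ : ρ = fun e => if e ∈ touches ends
    (cluster ends (flipTouch (endsD ends d)
        {x : V | x ∈ M2 (endsD ends d) r s ω ∧ x ≠ r ∧ x ≠ s} ω) d ∪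
      K2 (endsD ends d) r s (flipTouch (endsD ends d)
        {x : V | x ∈ M2 (endsD ends d) r s ω ∧ x ≠ r ∧ x ≠ s} ω) ∪
      M2 (endsD ends d) r s (flipTouch (endsD ends d)
        {x : V | x ∈ M2 (endsD ends d) r s ω ∧ x ≠ r ∧ x ≠ s} ω)) then
      flipTouch (endsD ends d) {x : V | x ∈ M2 (endsD ends d) r s ω ∧ x ≠ r ∧ x ≠ s} ω e
    else false)

include hdr hds hsep hD hK hM hρ in
/-- **The `W`-side of `ω` is a union of switchable blocks of its skeleton**: every `W`-side
vertex lies in a component of the sided set of the skeleton which is free of `d`-edges, not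
attached to the cluster of `d`, and contained in the `W`-side. -/
lemma wside_block_mem_fam_T :
    ∀ x ∈ {x : V | x ∈ M2 (endsD ends d) r s ω ∧ x ≠ r ∧ x ≠ s},
      ∃ C ∈ (comps (endsD ends d) r s ρ).filter (fun C =>
        (∀ e y, y ∈ C → ends e ≠ s(d, y)) ∧ ∀ e x y, ends e = s(x, y) → x ∈ C →
          y ∈ cluster ends ρ d → y ∈ C ∨ y = r ∨ y = s),
        x ∈ C ∧ (↑C : Set V) ⊆ {x : V | x ∈ M2 (endsD ends d) r s ω ∧ x ≠ r ∧ x ≠ s} := by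
  intro x hx
  obtain ⟨hfib, -⟩ := skel_fibre hdr hds hsep hD hρ
  have hB₁ := M2_endsD_norm hdr hds hsep hD (ω := ω)
  have hK₁ := K2_endsD_norm hdr hds hsep hD (ω := ω)
  have hKρ := K2_endsD_eq_on_unitFibre hdr hds hfib
  have hMρ := M2_endsD_eq_on_unitFibre hdr hds hfib
  have hclρ := cluster_d_eq_on_unitFibre hdr hds hB₁ hfib
  -- the sided sets of `ρ` and `ω` agree
  have hA0 : A0 (endsD ends d) r s ρ = A0 (endsD ends d) r s ω := by
    have h1 := sided_flipTouch_of_closed (sep2_endsD_of_sep2 hsep)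
      (C := {x : V | x ∈ M2 (endsD ends d) r s ω ∧ x ≠ r ∧ x ≠ s})
      (fun x hx => Or.inr hx.1) (fun h => h.2.1 rfl) (fun h => h.2.2 rfl)
      (closedIn_wside hdr hds hD)
    have h2 : sided (endsD ends d) r s ρ = sided (endsD ends d) r s (flipTouch (endsD ends d)
        {x : V | x ∈ M2 (endsD ends d) r s ω ∧ x ≠ r ∧ x ≠ s} ω) := by
      ext z
      simp only [sided, Set.mem_setOf_eq]
      rw [hKρ, hMρ]
    rw [h1, sided_eq_coe_A0, sided_eq_coe_A0] at h2
    exact Finset.coe_injective h2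
  -- the `W`-side carries no `d`-edge
  have hfreeW : ∀ e y, y ∈ {x : V | x ∈ M2 (endsD ends d) r s ω ∧ x ≠ r ∧ x ≠ s} →
      ends e ≠ s(d, y) := by
    intro e y hy hey
    -- a `Y` edge from `d` into `y ∈ M₂(G − d)`, `y ≠ r, s, d`, would make `y` doubly reached
    have he : ω e = false := by
      cases he : ω e
      · rfl
      · exfalso
        have hyd : y ≠ d := by rintro rfl; exact not_mem_M2_endsD hdr hds ω hy.1
        exact hD y hy.2.1 hy.2.2 hyd (mem_K2_of_open hK he hey) (M2_endsD_subset_M2 ω hy.1)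
    exact hM (mem_M2_of_closed (M2_endsD_subset_M2 ω hy.1) he (by rw [hey, Sym2.eq_swap]))
  have hxA : x ∈ A0 (endsD ends d) r s ρ := by
    rw [hA0, mem_A0]; exact ⟨Or.inr hx.1, hx.2.1, hx.2.2⟩
  have hCmem : compIn (endsD ends d) (↑(A0 (endsD ends d) r s ρ) : Set V) x ∈
      comps (endsD ends d) r s ρ := Finset.mem_image_of_mem _ hxA
  -- the component of `x` stays inside the `W`-side (closure)
  have hCW : (↑(compIn (endsD ends d) (↑(A0 (endsD ends d) r s ρ) : Set V) x) : Set V) ⊆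
      {x : V | x ∈ M2 (endsD ends d) r s ω ∧ x ≠ r ∧ x ≠ s} := by
    intro y hy
    rw [Finset.mem_coe, mem_compIn] at hy
    refine mem_of_conn_of_closed (ends := endsD ends d)
      (ω := chi (endsD ends d) (↑(A0 (endsD ends d) r s ρ) : Set V)) ?_ hx hy
    intro a ha b hab
    obtain ⟨_, e, he, hends⟩ := openGraph_adj.1 hab
    obtain ⟨u, hu, v, hv, huv⟩ := chi_eq_true_iff.1 he
    have hbA : b ∈ A0 (endsD ends d) r s ω := by
      rw [← hA0]
      rw [hends, Sym2.eq_iff] at huv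
      rcases huv with ⟨_, h2⟩ | ⟨_, h2⟩
      · rw [h2]; exact Finset.mem_coe.1 hv
      · rw [h2]; exact Finset.mem_coe.1 hu
    rw [mem_A0] at hbA
    exact closedIn_wside hdr hds hD e a b hends ha hbA
  refine ⟨compIn (endsD ends d) (↑(A0 (endsD ends d) r s ρ) : Set V) x,
    Finset.mem_filter.2 ⟨hCmem, fun e y hy => hfreeW e y (hCW (Finset.mem_coe.2 hy)), ?_⟩,
    mem_compIn_self _ x, hCW⟩
  -- not attached to the cluster of `d`
  intro e a y hay ha hy
  have haW := hCW (Finset.mem_coe.2 ha)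
  by_cases hyd : y = d
  · exact (hfreeW e a haW (by rw [hay, hyd, Sym2.eq_swap])).elim
  by_cases hyr : y = r
  · exact Or.inr (Or.inl hyr)
  by_cases hys : y = s
  · exact Or.inr (Or.inr hys)
  by_cases hyU : y ∈ K2 (endsD ends d) r s ρ ∪ M2 (endsD ends d) r s ρ
  · left
    have hyA : y ∈ A0 (endsD ends d) r s ρ := mem_A0.2 ⟨hyU, hyr, hys⟩
    have haA : a ∈ A0 (endsD ends d) r s ρ := by
      rw [hA0, mem_A0]; exact ⟨Or.inr haW.1, haW.2.1, haW.2.2⟩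
    have had : a ≠ d := by rintro rfl; exact not_mem_M2_endsD hdr hds ω haW.1
    have hde : d ∉ ends e := notMem_of_ends_ne hay had hyd
    have he : chi (endsD ends d) (↑(A0 (endsD ends d) r s ρ) : Set V) e = true :=
      chi_eq_true_iff.2 ⟨a, Finset.mem_coe.2 haA, y, Finset.mem_coe.2 hyA,
        by rw [endsD_of_notMem hde, hay]⟩
    exact mem_compIn.2 (conn_trans (mem_compIn.1 ha)
      (conn_of_openAdj ⟨e, he, by rw [endsD_of_notMem hde, hay]⟩))
  · exfalso
    have hyK₁ : y ∉ K2 (endsD ends d) r s (flipTouch (endsD ends d)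
        {x : V | x ∈ M2 (endsD ends d) r s ω ∧ x ≠ r ∧ x ≠ s} ω) :=
      fun h => hyU (by rw [hKρ]; exact Or.inl h)
    have hyK : y ∉ K2 (endsD ends d) r s ω := fun h => hyK₁ (by rw [hK₁]; exact Or.inl h)
    have hyW : y ∉ {x : V | x ∈ M2 (endsD ends d) r s ω ∧ x ≠ r ∧ x ≠ s} :=
      fun h => hyK₁ (by rw [hK₁]; exact Or.inr h)
    have hyM : y ∉ M2 (endsD ends d) r s ω := fun h => hyW ⟨h, hyr, hys⟩
    have hy₁ : y ∈ cluster ends (flipTouch (endsD ends d)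
        {x : V | x ∈ M2 (endsD ends d) r s ω ∧ x ≠ r ∧ x ≠ s} ω) d := by
      rw [← hclρ]; exact hy
    exact (wside_attachment hdr hds hD hK hay haW hyK hyM hyd).2
      (cluster_norm_subset hdr hds hsep hD hK hM hyK hyM hyd hy₁)

end WsideFam

end NoPocket

end Summit.Ventures.PercRepro2
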